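import Mathlib

/-!
# Stub B of line `dilation-dynamics` (crux `CardyShadowIsolated`, stmt-CriticalPhenomena-5767):
# the fixed-point criterion of topological dynamics

For a continuous real flow `Φ` on a compact connected Hausdorff space `X` and a fixed point `p`,
if (i) `p` is the maximal invariant set of one of its neighbourhoods `N` (every point whose whole
orbit stays in `N` is `p`), (ii) `p` is the limit as `t → -∞` of no other orbit and (iii) the limit
as `t → +∞` of no other orbit, then `X = {p}`.

Proof (Ura–Kimura / Bhatia–Szegő style, self-contained). Shrink `N` to a closed neighbourhood.
If some `x₀ ≠ p` exists then `p` is not isolated (connectedness). For every `m`, the tube lemma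
gives a neighbourhood `B_m` of `p` of points whose orbit stays in `N` during `[-m, m]`; pick
`y ∈ B_m ∖ {p}`; by (i) its orbit leaves `N` at some time `T`, `|T| > m`. If `T > 0`, the last
time `σ ≥ m` up to which the forward orbit stays in `N` gives an exit point `z = Φ σ y` on the
closed set `F = N ∩ closure Nᶜ` (which misses `p`) whose backward orbit stays in `N` during
`[-m, 0]`; if `T < 0`, the same for the reversed flow. By pigeonhole one of the two families of
closed sets `F ∩ {backward-trapped during [-m,0]}` (for `Φ` or for `Φ.reverse`) is nonempty for
all `m`, hence (compactness, nested) has a common point `z ∈ F` whose whole backward half-orbit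
stays in `N`. Every cluster point `w` of `Φ t z`, `t → -∞`, then has its whole orbit in `N`
(the α-limit set is invariant and contained in `N`), so `w = p` by (i); by compactness
`Φ t z → p`, and (ii) (resp. (iii)) gives `z = p ∈ F`, absurd.

No sorry, no named fact. This file proves the registered stub `stub_fixedPointCriterion` of
`Cruxes/CardyShadowIsolated/Lines/dilation_dynamics.lean` verbatim (by name and signature).
-/

namespace Summit.CriticalPhenomena.CardyFormulaZ2.Theorems.CardyShadowIsolated.DilationDynamics

open Set Filter Topology

section General

variable {X : Type*} [TopologicalSpace X]

/-- The set of points on the "exit set" `N ∩ closure Nᶜ` whose backward orbit stays in `N`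
during `[-m, 0]`. [folklore] -/
def trapSet (Φ : Flow ℝ X) (N : Set X) (m : ℝ) : Set X :=
  (N ∩ closure Nᶜ) ∩ {x | ∀ s ∈ Icc (-m) 0, Φ s x ∈ N}

/-- `trapSet` shrinks as the trapping time grows. [folklore] -/
theorem trapSet_antitone (Φ : Flow ℝ X) (N : Set X) : Antitone (trapSet Φ N) := by
  intro m m' hmm' x hx
  exact ⟨hx.1, fun s hs => hx.2 s ⟨by linarith [hs.1], hs.2⟩⟩

/-- `trapSet` is closed when `N` is. [folklore] -/
theorem isClosed_trapSet (Φ : Flow ℝ X) {N : Set X} (hN : IsClosed N) (m : ℝ) :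
    IsClosed (trapSet Φ N m) := by
  refine (hN.inter isClosed_closure).inter ?_
  have h : {x : X | ∀ s ∈ Icc (-m) 0, Φ s x ∈ N} = ⋂ s ∈ Icc (-m) (0 : ℝ), (Φ.toFun s) ⁻¹' N := by
    ext x
    simp only [mem_setOf_eq, mem_iInter, mem_preimage]
  rw [h]
  exact isClosed_biInter fun s _ => hN.preimage (Φ.continuous_toFun s)

/-- **Exit lemma.** If the forward orbit of `y` stays in the closed set `N` during `[0, m]` but
leaves `N` at some time `T ≥ 0`, then the last exit point before leaving lies on `N ∩ closure Nᶜ`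
and its backward orbit stays in `N` during `[-m, 0]`. [folklore] -/
theorem trapSet_nonempty_of_exit (Φ : Flow ℝ X) {N : Set X} (hN : IsClosed N) {y : X} {m : ℝ}
    (hm : 0 ≤ m) (htrap : ∀ t ∈ Icc 0 m, Φ t y ∈ N) {T : ℝ} (hT : 0 ≤ T) (hexit : Φ T y ∉ N) :
    (trapSet Φ N m).Nonempty := by
  set S : Set ℝ := {s | 0 ≤ s ∧ ∀ t ∈ Icc 0 s, Φ t y ∈ N} with hS
  have hmS : m ∈ S := ⟨hm, htrap⟩
  have hSne : S.Nonempty := ⟨m, hmS⟩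
  have hbdd : BddAbove S := by
    refine ⟨T, fun s hs => ?_⟩
    by_contra h
    push Not at h
    exact hexit (hs.2 T ⟨hT, h.le⟩)
  set σ : ℝ := sSup S with hσ
  have hmσ : m ≤ σ := le_csSup hbdd hmS
  have hσ0 : 0 ≤ σ := hm.trans hmσ
  have hcont : Continuous fun t : ℝ => Φ t y := Φ.continuous continuous_id continuous_const
  -- the orbit stays in `N` during `[0, σ)`
  have htrap' : ∀ t, 0 ≤ t → t < σ → Φ t y ∈ N := by
    intro t ht0 htσ
    obtain ⟨s, hs, hts⟩ := exists_lt_of_lt_csSup hSne htσ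
    exact hs.2 t ⟨ht0, hts.le⟩
  -- and at `σ` (closedness)
  have hσN : Φ σ y ∈ N := by
    rcases hσ0.eq_or_lt with h | h
    · have h0 := htrap 0 ⟨le_rfl, hm⟩
      rw [← h]
      exact h0
    · have hlim : Tendsto (fun t => Φ t y) (𝓝[<] σ) (𝓝 (Φ σ y)) :=
        (hcont.tendsto σ).mono_left nhdsWithin_le_nhds
      refine hN.mem_of_tendsto hlim ?_
      have hIoo : Ioo 0 σ ∈ 𝓝[<] σ := Ioo_mem_nhdsLT h
      filter_upwards [hIoo] with t ht
      exact htrap' t ht.1.le ht.2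
  have hall : ∀ t ∈ Icc 0 σ, Φ t y ∈ N := fun t ht =>
    (lt_or_eq_of_le ht.2).elim (htrap' t ht.1) fun h => h ▸ hσN
  -- after `σ` the orbit leaves `N` immediately
  have hex : ∀ n : ℕ, ∃ t, σ < t ∧ t < σ + 1 / ((n : ℝ) + 1) ∧ Φ t y ∉ N := by
    intro n
    have hn : (0 : ℝ) < 1 / ((n : ℝ) + 1) := by positivity
    set s' : ℝ := σ + 1 / ((n : ℝ) + 1) / 2 with hs'
    have hσs' : σ < s' := by rw [hs']; linarith
    have hs'S : s' ∉ S := notMem_of_csSup_lt hσs' hbdd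
    have h0s' : 0 ≤ s' := hσ0.trans hσs'.le
    have : ¬ ∀ t ∈ Icc 0 s', Φ t y ∈ N := fun h => hs'S ⟨h0s', h⟩
    push Not at this
    obtain ⟨t, ht, htN⟩ := this
    have hσt : σ < t := by
      by_contra hle
      push Not at hle
      exact htN (hall t ⟨ht.1, hle⟩)
    exact ⟨t, hσt, by rw [hs'] at ht; linarith [ht.2], htN⟩
  choose t ht using hex
  have htend : Tendsto t atTop (𝓝 σ) := by
    have h1 : Tendsto (fun n : ℕ => σ + 1 / ((n : ℝ) + 1)) atTop (𝓝 σ) := by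
      have := tendsto_one_div_add_atTop_nhds_zero_nat.const_add σ
      simpa using this
    refine tendsto_of_tendsto_of_tendsto_of_le_of_le tendsto_const_nhds h1
      (fun n => (ht n).1.le) (fun n => (ht n).2.1.le)
  have hσcl : Φ σ y ∈ closure Nᶜ :=
    mem_closure_of_tendsto ((hcont.tendsto σ).comp htend)
      (Eventually.of_forall fun n => (ht n).2.2)
  -- the exit point
  refine ⟨Φ σ y, ⟨hσN, hσcl⟩, fun s hs => ?_⟩
  show Φ s (Φ σ y) ∈ N
  rw [← Φ.map_add]
  exact hall (s + σ) ⟨by linarith [hs.1], by linarith [hs.2]⟩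

/-- Every cluster point, as `t → -∞`, of an orbit which stays in the closed set `N` for all
`t ≤ 0` lies in `N`. [folklore] -/
theorem mem_of_mapClusterPt_atBot (Φ : Flow ℝ X) {N : Set X} (hN : IsClosed N) {z w : X}
    (hz : ∀ s : ℝ, s ≤ 0 → Φ s z ∈ N) (hw : MapClusterPt w atBot fun t : ℝ => Φ t z) : w ∈ N := by
  have hle : Filter.map (fun t : ℝ => Φ t z) atBot ≤ 𝓟 N := by
    rw [Filter.le_principal_iff, Filter.mem_map]
    filter_upwards [eventually_le_atBot (0 : ℝ)] with s hs
    exact hz s hs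
  have h1 : ClusterPt w (𝓟 N) := ClusterPt.mono hw hle
  rw [← mem_closure_iff_clusterPt, hN.closure_eq] at h1
  exact h1

/-- The α-limit set is invariant: cluster points as `t → -∞` are mapped to cluster points.
[folklore] -/
theorem mapClusterPt_atBot_apply (Φ : Flow ℝ X) {z w : X}
    (hw : MapClusterPt w atBot fun t : ℝ => Φ t z) (t : ℝ) :
    MapClusterPt (Φ t w) atBot fun s : ℝ => Φ s z := by
  have h1 : MapClusterPt (Φ t w) atBot ((Φ.toFun t) ∘ fun s : ℝ => Φ s z) :=
    hw.continuousAt_comp (Φ.continuous_toFun t).continuousAt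
  have h2 : ((Φ.toFun t) ∘ fun s : ℝ => Φ s z) = (fun s : ℝ => Φ s z) ∘ fun s : ℝ => t + s := by
    funext s
    show Φ t (Φ s z) = Φ (t + s) z
    rw [Φ.map_add]
  rw [h2] at h1
  exact MapClusterPt.of_comp (tendsto_atBot_add_const_left atBot t tendsto_id) h1

/-- **Half of the criterion.** With `N` a closed neighbourhood of `p` isolating `p` and with a
trivial unstable set at `p`, the backward-trapped exit sets `trapSet Φ N m` cannot all be
nonempty. [folklore] -/
theorem false_of_forall_trapSet_nonempty [CompactSpace X] (Φ : Flow ℝ X) {N : Set X} {p : X}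
    (hN : IsClosed N) (hNp : N ∈ 𝓝 p) (hiso : ∀ x : X, (∀ t : ℝ, Φ t x ∈ N) → x = p)
    (hun : ∀ x : X, Tendsto (fun t : ℝ => Φ t x) atBot (𝓝 p) → x = p)
    (hall : ∀ m : ℕ, (trapSet Φ N (m : ℝ)).Nonempty) : False := by
  -- a common point of the nested closed nonempty sets
  have hdir : Directed (· ⊇ ·) fun m : ℕ => trapSet Φ N (m : ℝ) := by
    intro i j
    refine ⟨max i j, ?_, ?_⟩
    · exact trapSet_antitone Φ N (Nat.cast_le.2 (le_max_left i j))
    · exact trapSet_antitone Φ N (Nat.cast_le.2 (le_max_right i j))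
  obtain ⟨z, hz⟩ := IsCompact.nonempty_iInter_of_directed_nonempty_isCompact_isClosed
    (fun m : ℕ => trapSet Φ N (m : ℝ)) hdir hall
    (fun m => (isClosed_trapSet Φ hN _).isCompact) (fun m => isClosed_trapSet Φ hN _)
  rw [mem_iInter] at hz
  have hzF : z ∈ N ∩ closure Nᶜ := (hz 0).1
  have hzback : ∀ s : ℝ, s ≤ 0 → Φ s z ∈ N := by
    intro s hs
    have h := (hz ⌈-s⌉₊).2 s ⟨?_, hs⟩
    · exact h
    · have := Nat.le_ceil (-s)
      linarith
  -- every α-limit point of `z` has its whole orbit in `N`, hence is `p`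
  have huniq : ∀ w : X, MapClusterPt w atBot (fun t : ℝ => Φ t z) → w = p := by
    intro w hw
    exact hiso w fun t => mem_of_mapClusterPt_atBot Φ hN hzback (mapClusterPt_atBot_apply Φ hw t)
  -- so the backward orbit converges to `p`
  have htend : Tendsto (fun t : ℝ => Φ t z) atBot (𝓝 p) :=
    isCompact_univ.tendsto_nhds_of_unique_mapClusterPt (Eventually.of_forall fun _ => mem_univ _)
      fun w _ hw => huniq w hw
  have hzp : z = p := hun z htend
  -- but `z` lies on the exit set, which misses `p`
  have hp : p ∈ interior N := mem_interior_iff_mem_nhds.2 hNp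
  have hz2 : z ∈ closure Nᶜ := hzF.2
  rw [closure_compl, hzp] at hz2
  exact hz2 hp

end General

/-- **The fixed-point criterion** (registered stub `stub_fixedPointCriterion` of line
`dilation-dynamics`, verbatim): in a compact connected Hausdorff space with a continuous real
flow, a fixed point that is an isolated invariant set with trivial unstable and stable sets is
the whole space. [folklore] -/
theorem stub_fixedPointCriterion :
    ∀ (X : Type) [TopologicalSpace X] [CompactSpace X] [T2Space X] [ConnectedSpace X]
      (Φ : Flow ℝ X) (p : X), (∀ t : ℝ, Φ t p = p) →
      (∃ N ∈ 𝓝 p, ∀ x : X, (∀ t : ℝ, Φ t x ∈ N) → x = p) →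
      (∀ x : X, Tendsto (fun t : ℝ => Φ t x) atBot (𝓝 p) → x = p) →
      (∀ x : X, Tendsto (fun t : ℝ => Φ t x) atTop (𝓝 p) → x = p) →
      ∀ x : X, x = p := by
  intro X _ _ _ _ Φ p hfix hiso hun hst
  obtain ⟨N₀, hN₀, hiso₀⟩ := hiso
  obtain ⟨N, hNnhds, hNclosed, hNsub⟩ := exists_mem_nhds_isClosed_subset hN₀
  have hisoN : ∀ x : X, (∀ t : ℝ, Φ t x ∈ N) → x = p :=
    fun x hx => hiso₀ x fun t => hNsub (hx t)
  by_contra hcon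
  push Not at hcon
  obtain ⟨x₀, hx₀⟩ := hcon
  -- `p` is not an isolated point of the connected space `X`
  have hnotiso : ∀ U ∈ 𝓝 p, ∃ y ∈ U, y ≠ p := by
    intro U hU
    by_contra h
    push Not at h
    have hsing : ({p} : Set X) ∈ 𝓝 p := mem_of_superset hU fun y hy => h y hy
    have hopen : IsOpen ({p} : Set X) :=
      isOpen_iff_mem_nhds.2 fun y hy => by rw [mem_singleton_iff.1 hy]; exact hsing
    have hclopen : IsClopen ({p} : Set X) := ⟨isClosed_singleton, hopen⟩
    rcases isClopen_iff.1 hclopen with h0 | h1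
    · exact (singleton_ne_empty p) h0
    · exact hx₀ (by rw [← mem_singleton_iff, h1]; exact mem_univ _)
  -- for every `m`, an exit point for `Φ` or for the reversed flow
  have hkey : ∀ m : ℕ,
      (trapSet Φ N (m : ℝ)).Nonempty ∨ (trapSet Φ.reverse N (m : ℝ)).Nonempty := by
    intro m
    have hB : {x : X | ∀ t ∈ Icc (-(m : ℝ)) m, Φ t x ∈ N} ∈ 𝓝 p := by
      have hK : IsCompact (Icc (-(m : ℝ)) m) := isCompact_Icc
      have hP : ∀ t ∈ Icc (-(m : ℝ)) m,
          ∀ᶠ z : X × ℝ in 𝓝 (p, t), Φ z.2 z.1 ∈ interior N := by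
        intro t _
        have hc : Continuous fun z : X × ℝ => Φ z.2 z.1 :=
          Φ.continuous continuous_snd continuous_fst
        have hpt : Φ t p ∈ interior N := by
          rw [hfix]
          exact mem_interior_iff_mem_nhds.2 hNnhds
        exact hc.continuousAt.eventually_mem (isOpen_interior.mem_nhds hpt)
      have h := hK.eventually_forall_of_forall_eventually
        (P := fun (x : X) (t : ℝ) => Φ t x ∈ interior N) hP
      exact h.mono fun x hx t ht => interior_subset (hx t ht)
    obtain ⟨y, hy, hyp⟩ := hnotiso _ hB
    have hleave : ∃ T : ℝ, Φ T y ∉ N := by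
      by_contra h
      push Not at h
      exact hyp (hisoN y h)
    obtain ⟨T, hT⟩ := hleave
    rcases le_or_gt 0 T with hT0 | hT0
    · left
      exact trapSet_nonempty_of_exit Φ hNclosed (Nat.cast_nonneg m)
        (fun t ht => hy t ⟨by linarith [ht.1], ht.2⟩) hT0 hT
    · right
      refine trapSet_nonempty_of_exit Φ.reverse hNclosed (y := y) (Nat.cast_nonneg m)
        (fun t ht => ?_) (neg_nonneg.2 hT0.le) ?_
      · show Φ (-t) y ∈ N
        exact hy (-t) ⟨by linarith [ht.2], by linarith [ht.1]⟩
      · show Φ (-(-T)) y ∉ N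
        rw [neg_neg]
        exact hT
  -- pigeonhole: one of the two nested families is nonempty for every `m`
  have hdich : (∀ m : ℕ, (trapSet Φ N (m : ℝ)).Nonempty) ∨
      (∀ m : ℕ, (trapSet Φ.reverse N (m : ℝ)).Nonempty) := by
    by_contra h
    push Not at h
    obtain ⟨⟨m₁, hm₁⟩, ⟨m₂, hm₂⟩⟩ := h
    rcases hkey (max m₁ m₂) with h1 | h2
    · have hsub := trapSet_antitone Φ N (Nat.cast_le.2 (le_max_left m₁ m₂) :
        ((m₁ : ℕ) : ℝ) ≤ ((max m₁ m₂ : ℕ) : ℝ))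
      obtain ⟨z, hz⟩ := h1
      have : z ∈ trapSet Φ N (m₁ : ℝ) := hsub hz
      rw [hm₁] at this
      exact this
    · have hsub := trapSet_antitone Φ.reverse N (Nat.cast_le.2 (le_max_right m₁ m₂) :
        ((m₂ : ℕ) : ℝ) ≤ ((max m₁ m₂ : ℕ) : ℝ))
      obtain ⟨z, hz⟩ := h2
      have : z ∈ trapSet Φ.reverse N (m₂ : ℝ) := hsub hz
      rw [hm₂] at this
      exact this
  rcases hdich with hall | hall
  · exact false_of_forall_trapSet_nonempty Φ hNclosed hNnhds hisoN hun hall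
  · refine false_of_forall_trapSet_nonempty Φ.reverse hNclosed hNnhds (fun x hx => ?_)
      (fun x hx => ?_) hall
    · exact hisoN x fun t => by simpa using hx (-t)
    · apply hst x
      have h : (fun t : ℝ => Φ t x) = (fun t : ℝ => Φ.reverse t x) ∘ Neg.neg := by
        funext t
        simp
      rw [h]
      exact hx.comp tendsto_neg_atTop_atBot

end Summit.CriticalPhenomena.CardyFormulaZ2.Theorems.CardyShadowIsolated.DilationDynamics
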